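import Literature.AnabelianGeometry.AbsoluteAnabelian.AbsTopII.BelyiCuspidalizationContent

/-!
# [AbsTopII] Cor 3.7 (a) content conjunct, v2: the `U`-slot of the •-tail (`RealizesChain'`, `Cor_3_7″`)

S. Mochizuki, *Topics in Absolute Anabelian Geometry II* [AbsTopII] (bib `MochizukiAbsTopII2013`;
locators = PDF pages of the kurims manuscript `paper:url-585b8d0ad0d9`), §3, Example 3.6 (i) p. 71,
Cor 3.7 (a) p. 73; [AbsTopI] (`MochizukiAbsTopI2012`) Def 4.2 (iii) pp. 49–50.  Example 3.6 (i):

> "the chain `P ⇝ W ⇝ W_n ⇝ ⋯ ⇝ W_1 = U ⇝ U_m ⇝ ⋯ ⇝ U_1 = V` whose associated type-chain is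
> `⋏, •, …, •` [i.e., a finite étale covering, followed by `n + m` de-cuspidalizations]"

and Cor 3.7 (a) p. 73: "the natural surjection `Π_U ↠ Π_V` may be recovered from the chain of •’s
terminating at the second to last group of the above-mentioned `Π`-chain".

Statements file (2 predicates), abc-iut-L4-t6 lineage, SUCCESSOR of `BelyiCuspidalization.RealizesChain`
/ `BelyiModel.Cor_3_7′` (`AbsTopII/BelyiCuspidalizationContent.lean`, p432148 — kept as the superseded
edge), repairing FINDING F-f067g2-1 (abc-iut-f-067, concurred by abc-iut-f-064; abc-iut-L4-lead RULING
#7s): in v1 the term identified with `Π_U` sits `n + m` •-steps before the second-to-last term `Π_V`,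
which is the slot of `Π_W` (the Belyi-étale locus `W → P`), not of `Π_U`; by Example 3.6 (i) the block of
`n + m` de-cuspidalizations splits as `W ⇝ ⋯ ⇝ W_1 = U` (`n` steps) followed by `U ⇝ ⋯ ⇝ U_1 = V`
(`m` steps), so `Π_U` sits `m` steps before `Π_V` and "`Π_U ↠ Π_V`" is the composite of the LAST `m`
operation homomorphisms.  v2 below moves the `U`-slot to `t − m` (`m = chainParams.2.2`) and records
the `W`-slot `w = s − n` (`n = chainParams.2.1`; no datum of the output is attached to `Π_W`, the slot is
pinned for the record).  Everything else is verbatim v1 (`ChainGroup.IsDeCuspVia`, the isomorphisms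
over `G` up to inner automorphisms, the composite tracked by `ψ`).
HONEST FRAMING: predicates on an OUTPUT structure / a MODEL INTERFACE the tree does not instantiate;
typed ≠ proved; the finding is about OUR typing; nothing here bears on [IUTchIII] Cor 3.12.
-/

noncomputable section

open CategoryTheory Topology
open scoped Pointwise

universe u

namespace Literature.AnabelianGeometry.AbsoluteAnabelian.AbsTopII

open Literature.AlgebraicGeometry.Frobenioids (IsSlimGroup)
open FundamentalExtension
open AbsTopI (ConstructionDataClass)

namespace BelyiCuspidalization

variable {E : FundamentalExtension.{u}} (B : BelyiCuspidalization E)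
  (C : CuspidalData E) (hP : IsSlimGroup E.arith) (hΔ : IsSlimGroup E.geom) (hne : E.geom ≠ ⊥)

/-- **Cor 3.7 (a), the CONTENT of the chain clause, v2 (`U`-slot per Example 3.6 (i))**: a genuine
`Π`-chain `c` ([AbsTopI] Def 4.2 (iii)) of the output's recorded type-chain `⋏, ⋎, •^l, ⋏, •^(n+m), ⋎`
with a terminal isomorphism to the trivial chain; indices `w ≤ s ≤ t` with `t` second-to-last,
`s − w = n` ("`W ⇝ W_n ⇝ ⋯ ⇝ W_1 = U`") and `t − s = m` ("`U ⇝ U_m ⇝ ⋯ ⇝ U_1 = V`"); isomorphisms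
`Π_s ≅ Π_U` (the output's `cuspU`) and `Π_t ≅ Π_V` over `G` up to inner automorphisms; and operation
homomorphisms `φⱼ : Πⱼ ↠ Πⱼ₊₁` OF TYPE • for `s ≤ j < t` whose composite (tracked by `ψ`) is, through
the two isomorphisms, the output's "natural surjection `Π_U ↠ Π_V`" — "recovered from the chain of •’s
terminating at the second to last group" (p. 73).  Successor of `RealizesChain` (v1, `U`-slot misplaced
at `t − (n + m)`: finding F-f067g2-1). [cite: MochizukiAbsTopII2013, Cor 3.7 (a) p.73] -/
def RealizesChain' : Prop :=
  ∃ c : E.PiChain C hP hΔ hne,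
    c.typeChain = B.typeChain.map ElementaryOp.toElemOpType ∧
    c.HasTerminalIso (trivialChain C hP hΔ hne) ∧
    ∃ (w s t : Fin (c.len + 1)) (_ : w.val + B.chainParams.2.1 = s.val)
      (_ : s.val + B.chainParams.2.2 = t.val) (_ : t.val + 1 = c.len)
      (eU : B.cuspU.arith ≃ₜ* (c.term s).grp) (eV : ↥B.PiV ≃ₜ* (c.term t).grp) (gU gV : E.gal)
      (ψ : ∀ i : Fin (c.len + 1), B.cuspU.arith →* (c.term i).grp),
      (∀ x, (c.term s).proj (eU x) = MulAut.conj gU (B.projU.gal (B.cuspU.aug x))) ∧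
      (∀ y : B.PiV, (c.term t).proj (eV y) = MulAut.conj gV (E.aug y)) ∧
      (∀ x, ψ s x = eU x) ∧
      (∀ j : Fin c.len, s.val ≤ j.val → j.val < t.val →
        ∃ φ : (c.term j.castSucc).grp →ₜ* (c.term j.succ).grp,
          ChainGroup.IsDeCuspVia C (c.term j.castSucc) (c.term j.succ) φ ∧
            ∀ x, ψ j.succ x = φ (ψ j.castSucc x)) ∧
      (∀ x, ((eV.symm (ψ t x) : ↥B.PiV) : E.arith) = B.projU.arith x)

end BelyiCuspidalization

namespace BelyiModel

variable {𝒟 : ConstructionDataClass.{u}} (M : BelyiModel 𝒟)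

/-- **Corollary 3.7** pp. 72–73 relative to `(𝒟, M)` with the content of (a), v2 (`U`-slot per
Example 3.6 (i); successor of `Cor_3_7′`, finding F-f067g2-1): under "`𝒟` chain-full, rel-isom-DGC" and
the standing hypotheses (`IsCor37Member`), for every NF-rational open `U_X`, some `BelyiCuspidalization`
of `Π ↠ G` has output isomorphic over `Π` to the model's `π₁(U_X) ↠ Π` (b), the same images of cuspidal
decomposition groups (c), and realizes a genuine `Π`-chain whose last `m` •'s compute its `Π_U ↠ Π_V`
(a) (`RealizesChain'`).  Supersedes `Cor_3_7` / `Cor_3_7′` for consumers.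
[cite: MochizukiAbsTopII2013, Cor 3.7 pp.72-73] -/
def Cor_3_7'' : Prop :=
  𝒟.IsChainFull → 𝒟.RelIsomDGC →
    ∀ (b : 𝒟.Base) (X : (𝒟.datum b).Obj) (h : M.IsCor37Member b X) (U : M.NFOpen b X),
      ∃ B : BelyiCuspidalization ((𝒟.datum b).ext X),
        B.cusp.IsoOver (M.cuspOf U) ∧
          B.cusp.decompositionImages B.cusps = (M.cuspOf U).decompositionImages (M.cuspsOf U) ∧
          B.RealizesChain' (M.cusps b X) h.arith_slim h.geom_slim h.geom_ne_bot

end BelyiModel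

end Literature.AnabelianGeometry.AbsoluteAnabelian.AbsTopII
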